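import Summits.KontsevichZagierPeriods.KontsevichZagierPeriods.Theses.EulerFormChain
import Summits.KontsevichZagierPeriods.KontsevichZagierPeriods.Theorems.FurushoPentagonSectorToKernelRealStokesForm
import Summits.KontsevichZagierPeriods.KontsevichZagierPeriods.Theorems.FurushoPentagonSectorToKernelOfLeaves

/-!
# Birth skeleton (hypotheses form, sorry-free) — piece X₂ `AyoubCubeLocalKernel` (stmt-KontsevichZagierPeriods-19074) of the split of
# the deciding crux `PiPowerStratum` (stmt-KontsevichZagierPeriods-11792, route EulerFormChain)

Crux-strategist re-audit r1, line `pi-germ-transfer`.  X₂ says: for every pinned disc product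
`P n r = [π] ⋆ r` and every Ayoub-ADMISSIBLE cube representation `s` (its integrand is, on `[0,1]ᵐ`, the
sum of one real power series `F` of polyradius `> 1`, algebraic over `ℚ(x)`), `∫ s = 0` forces
`([π]⋆)^N [s] ∈ KZ.relations` for some `N`.  The honest skeleton is the LOCALISATION CUT carried through
Ayoub's algebra `𝒪_{ℚ-alg}(𝔻̄^∞)` with a CANONICAL real `π`-germ:

* the germ `θ_v(z) = 6/√(4 − z_v²) = 3 Σ_k C(2k,k) z_v^{2k}/16^k` (rational coefficients, radius `2`,
  `θ² (4 − z²) = 36`, `∫₀¹ θ = 6·arcsin(1/2) = π`), characterised coefficientwise inside the stub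
  signatures (closed form over Mathlib + `AyoubRel`, no skeleton-local definition enters a signature);
* `stub_oanLocalizedKernelPi` (conjecture-grade; Kontsevich's period conjecture for Ayoub's presentation
  AFTER inverting `π`, i.e. what torsor / motivic-Galois methods deliver): `F ∈ 𝒪_{ℚ-alg}`, `∫ F = 0`, `F`
  in the variables `< v` ⇒ for some `N`, `(∏_{l<N} θ_{v+l}) · F` lies in the `ℚ`-span of the type-(a)
  elements `∂G/∂zᵢ − G|_{zᵢ=1} + G|_{zᵢ=0}`;
* `stub_germProductRelation` + `stub_piGermChain` (transcendence-free; formerly one stub `stub_piGermTransport`; the localised twin of the landed S3–S5 chain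
  `stub_realStokesForm` / `stub_semialgebraicOfAlgebraic` / `stub_stokesSpanCalibration`): such a
  certificate for `(∏ θ) · F_ℂ`, `F_ℂ` the complexification of the series of `s`, yields
  `([π]⋆)^N [s] ∈ relations` — realify the certificate, sum it on `[0,1]^{m+N+d}`, calibrate the real
  Stokes form, un-pad, and trade each germ factor `[[0,1], 6/√(4−x²)]` for a disc `[π]` by ONE fixed move
  chain run fibrewise (a Conjecture-1 instance for ONE explicit pair of value `π`, not for a family:
  this is why the germ is canonical and not `∃ g, ∫ g = (2πi)^N`);
* DE-RISKED: stub 2 at `N = 0` is PROVED sorry-free in `Cruxes/PiPowerStratum/X2PiGermTransportZero.lean`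
  (`realStokesForm_of_mem_kSpan` = localised S3 from a local certificate; `piGermTransport_zero`);
* `AyoubCubeLocalKernel_of : stub₁ → stub₂ → stub₃ → AyoubCubeLocalKernel` (kernel-checked: formal algebraic
  relation `stub_formalIffFunctional`, complexification `rsf_complexify`, termwise integration
  `stub_termwiseOfSummable`, all landed).

References: J. Ayoub, Ann. of Math. 181 (2015), Conj. 1.1, §1.1; J. Ayoub, Tohoku Math. J. 71 (2019)
(= AyoubRelKZRevisited), Thm. 1.11, Notation 1.9 (iii), Rem. 1.3; M. Kontsevich, D. Zagier, *Periods*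
(2001), §1.1 (the `π` chain), §4.1; A. Huber, S. Müller-Stach (2017), §13.1–13.2.
-/

noncomputable section

-- `Summit.KontsevichZagierPeriods.KontsevichZagierPeriods.…` is the tree's mandated layout (single-conjunct summit).
set_option linter.dupNamespace false

namespace Summit.KontsevichZagierPeriods.KontsevichZagierPeriods.Cruxes.AyoubCubeLocalKernel.PiGermTransfer.Hyps

open MeasureTheory
open Literature.NumberTheory.Transcendental
open Literature.NumberTheory.Transcendental.KZ hiding cubicalSpan
open Literature.NumberTheory.Transcendental.AyoubRel (CSeries Oan intC relAC kSpan DependsOnlyOnLT)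
open Summit.KontsevichZagierPeriods.FurushoPentagon.SectorToKernel
open Summit.KontsevichZagierPeriods.KontsevichZagierPeriods.Theses.EulerFormChain (AyoubCubeLocalKernel)

/-! ## The canonical germ (used only inside the composition proof) -/

/-- `θ_v = 3 Σ_k C(2k,k) z_v^{2k} / 16^k`, the power series of `6/√(4 − z_v²)`. [folklore] -/
def piGerm (v : ℕ) : CSeries := fun a =>
  if a = Finsupp.single v (a v) ∧ Even (a v) then
    (3 * (Nat.centralBinom (a v / 2) : ℂ)) / (16 : ℂ) ^ (a v / 2) else 0

/-- The coefficient characterisation of `piGerm` is definitional. [folklore] -/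
theorem coeff_piGerm (v : ℕ) (a : ℕ →₀ ℕ) : MvPowerSeries.coeff a (piGerm v) =
    if a = Finsupp.single v (a v) ∧ Even (a v) then
      (3 * (Nat.centralBinom (a v / 2) : ℂ)) / (16 : ℂ) ^ (a v / 2) else 0 := rfl

/-! ## Composition with the stubs as hypotheses (sorry-free) -/

/-- **X₂ from its three stubs as hypotheses** (sorry-free), concluding the route decl `EulerFormChain.AyoubCubeLocalKernel`
(stmt-KontsevichZagierPeriods-19074) BY NAME: the functional algebraic relation of the admissible data is
formal (`stub_formalIffFunctional`), the complexified series lies in `𝒪_{ℚ-alg}` with `∫ = ∫_{[0,1]ᵐ} s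
= s.value = 0` (`rsf_complexify`, `stub_termwiseOfSummable`), stub 1 gives the germ certificate, stub 2
turns it into the product relation `[T] ∈ relations`, stub 3 trades `T` for `([π]⋆)^N [s]`.
[cite: Ayoub2015, Conj. 1.1] [folklore] -/
theorem ayoubCubeLocalKernel_of_hyps
    (hloc : ∀ (θ : ℕ → CSeries),
    (∀ (v : ℕ) (a : ℕ →₀ ℕ), MvPowerSeries.coeff a (θ v) =
      if a = Finsupp.single v (a v) ∧ Even (a v) then
        (3 * (Nat.centralBinom (a v / 2) : ℂ)) / (16 : ℂ) ^ (a v / 2) else 0) →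
    ∀ (F : CSeries) (v : ℕ), F ∈ Oan (Rat.castHom ℂ) → DependsOnlyOnLT F v → intC F = 0 →
      ∃ N : ℕ, (∏ l ∈ Finset.range N, θ (v + l)) * F ∈
        kSpan (Rat.castHom ℂ) {x : CSeries | ∃ G ∈ Oan (Rat.castHom ℂ), ∃ i : ℕ, x = relAC i G})
    (hprod : ∀ (θ : ℕ → CSeries),
    (∀ (v : ℕ) (a : ℕ →₀ ℕ), MvPowerSeries.coeff a (θ v) =
      if a = Finsupp.single v (a v) ∧ Even (a v) then
        (3 * (Nat.centralBinom (a v / 2) : ℂ)) / (16 : ℂ) ^ (a v / 2) else 0) →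
    ∀ (m : ℕ) (s : IntegralRep m), s.domain = KZ.cube m →
    ∀ (F : MvPowerSeries (Fin m) ℝ) (ρ : ℝ), 1 < ρ →
      Summable (fun a : Fin m →₀ ℕ => |MvPowerSeries.coeff a F| * ρ ^ (a.sum fun _ e => e)) →
      (∀ x ∈ KZ.cube m, HasSum (fun a : Fin m →₀ ℕ => MvPowerSeries.coeff a F * a.prod (fun j e => x j ^ e))
        (s.integrand x)) →
    ∀ (N : ℕ), (∏ l ∈ Finset.range N, θ (m + l)) *
        MvPowerSeries.map (algebraMap ℝ ℂ) (MvPowerSeries.rename (Fin.valEmbedding : Fin m ↪ ℕ) F) ∈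
          kSpan (Rat.castHom ℂ) {x : CSeries | ∃ G ∈ Oan (Rat.castHom ℂ), ∃ i : ℕ, x = relAC i G} →
      ∃ T : IntegralRep (m + N), T.domain = KZ.cube (m + N) ∧
        (∀ z ∈ KZ.cube (m + N), T.integrand z =
          s.integrand (fun a => z (Fin.castAdd N a)) * ∏ l : Fin N, 6 / Real.sqrt (4 - z (Fin.natAdd m l) ^ 2)) ∧
        of T ∈ relations)
    (hchain : ∀ (P : ∀ n : ℕ, IntegralRep n → IntegralRep (n + 2)),
      (∀ (n : ℕ) (r : IntegralRep n), (P n r).domain = {z : Fin (n + 2) → ℝ | z 0 ^ 2 + z 1 ^ 2 ≤ 1 ∧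
          (fun i : Fin n => z i.succ.succ) ∈ r.domain} ∧
        (P n r).integrand = fun z => r.integrand (fun i : Fin n => z i.succ.succ)) →
    ∀ (m N : ℕ) (s : IntegralRep m) (T : IntegralRep (m + N)),
      s.domain = KZ.cube m → T.domain = KZ.cube (m + N) →
      (∀ z ∈ KZ.cube (m + N), T.integrand z =
          s.integrand (fun a => z (Fin.castAdd N a)) * ∏ l : Fin N, 6 / Real.sqrt (4 - z (Fin.natAdd m l) ^ 2)) →
      of T - (⇑(FreeAbelianGroup.lift (fun t : (Σ n, IntegralRep n) => of (P t.1 t.2))))^[N] (of s) ∈ relations) :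
    AyoubCubeLocalKernel := by
  intro P hP m s hsd hadm hs0
  obtain ⟨F, ρ, hρ, hsum, hF, Q, hQ0, hQ⟩ := hadm
  -- (1) the functional algebraic relation on the cube is formal
  have hPF := (stub_formalIffFunctional m F ρ hρ hsum s.integrand hF Q).mpr hQ
  -- (2) complexify: `F_ℂ ∈ 𝒪_{ℚ-alg}`, variables `< m`, `∫ F_ℂ = Σ_a c_a ∏ (a_j+1)⁻¹`
  obtain ⟨hOan, hdep, hint⟩ := rsf_complexify m F ρ hρ hsum Q hQ0 hPF
  -- (3) `∫ F_ℂ = ∫_{[0,1]ᵐ} s = s.value = 0`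
  have hcube : ∫ x in KZ.cube m, s.integrand x = 0 := by
    rw [← leaves_eval_of_eq_setIntegral_cube s hsd, eval_of, hs0]
  have h0 : intC (MvPowerSeries.map (algebraMap ℝ ℂ)
      (MvPowerSeries.rename (Fin.valEmbedding : Fin m ↪ ℕ) F)) = 0 := by
    rw [hint, ((stub_termwiseOfSummable m F ρ hρ hsum s.integrand hF).1).tsum_eq, hcube,
      Complex.ofReal_zero]
  -- (4) the germ certificate (stub 1 at `v := m` with the canonical germ)
  obtain ⟨N, hN⟩ := hloc piGerm coeff_piGerm _ m hOan hdep h0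
  -- (5) the product relation `[T] ∈ relations` (stub 2) and (6) the fibrewise π-chain (stub 3)
  obtain ⟨T, hTd, hTi, hT⟩ := hprod piGerm coeff_piGerm m s hsd F ρ hρ hsum hF N hN
  have hc := hchain P hP m N s T hsd hTd hTi
  refine ⟨N, ?_⟩
  have := relations.sub_mem hT hc
  simpa using this

end Summit.KontsevichZagierPeriods.KontsevichZagierPeriods.Cruxes.AyoubCubeLocalKernel.PiGermTransfer.Hyps
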